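import Literature.Combinatorics.Sahi2008.LebesgueSquare
import HarnessLib

/-!
# Lieb–Sahi (2022): the discretisation Lemma 2.3 / 3.8 on the unit hypercube `Q_d = [0,1]^d` —
# Lebesgue measure on `Q_d` versus the uniform weight on the discrete boxes `[M]^d`

Topic `Literature/Combinatorics/Sahi2008` (sequel of `LebesgueSquare.lean`, which does `d = 2` and proves
Theorem 3.7 as printed, and of `MeasureFunctional.lean` — the measure-level functional
`msahiE (μ : Measure Ω) n f`, its moment polynomial `momentE`, `MSahiPositive μ n`).

## Source (read 2026-08-20 from the materialised arXiv text, corpus `paper:arxiv-2107.09838`, pp. 3, 5, 8)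

E. H. Lieb, S. Sahi, *On the extension of the FKG inequality to `n` functions*, J. Math. Phys. **63** (2022)
043301 = arXiv:2107.09838 [LiebSahi2021]:
> (§1) "In formulating (sup-mod) we have tacitly assumed that the poset `L` is a discrete set. However the
> FKG inequality also has important continuous versions, which can be proved by discrete approximation. For
> example, if `Q_k = [0,1]^k` is the unit hypercube in `ℝ^k` equipped with the partial order: `x ≥ y` iff
> `x_i ≥ y_i` for all `i`, then the FKG inequality holds for the Lebsegue measure …"
> "In the present paper we provide further evidence in support of Conjecture 1.1. We consider the continuous
> case of the Lebesgue measure on the unit hypercube `Q_k = [0,1]^k` in `ℝ^k` …"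
> (§2) "We will consider the functional `E_3` for functions on the unit hypercube `Q_k = [0,1]^k` … equipped
> with the Lebesgue measure and the usual partial order … a real valued function `f` on `Q_k` is monotone
> (decreasing) if `x ≤ x'` implies `f(x) ≥ f(x')`."
> "**LEMMA 2.3.** It suffices to prove Theorem 2.1 for `χ_a, χ_b, χ_c`; `a, b, c ∈ 𝒜(m)`; for all `m`.
> Proof: … Divide `Q_2` uniformly into `m²` little squares … converge … in `L¹` as `m → ∞`."
> "**LEMMA 3.8.** It suffices to prove Theorem 3.7 for `χ_{a^1},…,χ_{a^n}`, `a^i ∈ 𝒜(m)`, for all `m`."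

## What is here (everything PROVED; no named facts; axioms standard)

Lieb–Sahi's discretisation, written once and for all in dimension `d` (their Lemma 2.3 / 3.8 is `d = 2`;
the proof of Theorem 3.5 uses the same device in `Q_k`): the uniform `(m+1)^d` grid of
`Q_d = (Fin d → unitInterval)`, its cell map `cubeCell m : Q_d → [m+1]^d`, the lower / upper corners
`loCube m c ≤ x ≤ hiCube m c` of the cell of `x`, the uniform probability weight `cubeWeight d m = (m+1)^{-d}`
on the box `[m+1]^d = (Fin d → Fin (m+1))`, and

* `integral_comp_cubeCell` — a grid step function integrates to its uniform-box expectation;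
* `lowerSum_le_integral`, `integral_le_upperSum`, `upperSum_sub_lowerSum_le` — the Riemann sandwich of a
  monotone `g : Q_d → ℝ`, with the gap bound `U_m(g) − L_m(g) ≤ d · (g(1,…,1) − g(0,…,0)) / (m+1)`
  (coordinatewise telescoping, by induction on `d`; `sum_gap_mul_le`);
* `Monotone.aestronglyMeasurable_unitCube`, `Monotone.integrable_unitCube` — monotone functions on `Q_d` are
  a.e. Borel and integrable for Lebesgue measure (so no measurability hypothesis is ever needed);
* `tendsto_gridMoment` — the joint moments of the grid family `f_i ∘ loCube m` under the uniform box weight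
  converge to the Lebesgue joint moments of `f`;
* **`msahiE_volume_nonneg_of_cubeWeight`** — Lemma 3.8 in dimension `d`: if the uniform weight on every box
  `[m+1]^d` is Sahi-positive of order `n` then `E_n(f_0,…,f_{n−1}) ≥ 0` for Lebesgue measure on `Q_d` and all
  nonnegative monotone `f_i` (`E_n` is a continuous polynomial in the joint moments, `continuous_momentE`);
* **`sahiE_cubeWeight_eq_msahiE`**, `sahiPositive_cubeWeight_of_mSahiPositive` — conversely a monotone family
  on the box `[m+1]^d` is the grid step family of Lebesgue measure (`h_i ∘ cubeCell m`), so Sahi positivity of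
  Lebesgue measure on `Q_d` gives it on every uniform box;
* **`mSahiPositive_volume_iff_uniformGrid d n`** — the two together:
  `MSahiPositive (volume : Measure (Fin d → I)) n ↔ ∀ M ≥ 1, SahiPositive (uniform weight on [M]^d) n`, the
  right-hand side in the form used by the tree's width stratification (`Summits/…/…SahiUniformGrid.lean`).

Motivation (this programme, crux `stmt-CriticalPhenomena-4575`, cell prim-sahi): the continuous case of
Lieb–Sahi's Conjecture 1.1 (Lebesgue measure on all unit hypercubes) is thereby equivalent, order by order, to
Sahi's Conjecture 5 on all finite FKG posets (Summits file `SahiLiebSahiContinuum.lean`).  NOTHING here asserts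
any conjecture; `MSahiPositive` / `SahiPositive` occur only in equivalences and proved implications.
-/

noncomputable section

namespace Literature.Combinatorics.Sahi2008

open Finset Function MeasureTheory Set Filter Topology
open scoped unitInterval

namespace LebesgueCube

open LebesgueSquare

/-! ### One-dimensional plumbing (the grid of `[0,1]`, from `LebesgueSquare`) -/

variable {m : ℕ}

/-- The coordinate of the grid point `a/N`, `a ≤ N` (plumbing). [folklore] -/
private theorem coe_gridPt_of_le {N a : ℕ} (hN : 0 < N) (h : a ≤ N) : (gridPt N a : ℝ) = (a : ℝ) / N := by
  change min ((a : ℝ) / N) 1 = _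
  rw [min_eq_left]
  rw [div_le_one (by exact_mod_cast hN)]
  exact_mod_cast h

/-- Grid points increase with the index (plumbing). [folklore] -/
private theorem gridPt_mono (N : ℕ) : Monotone (gridPt N) := by
  intro a b hab
  change min ((a : ℝ) / N) 1 ≤ min ((b : ℝ) / N) 1
  exact min_le_min_right _ (div_le_div_of_nonneg_right (by exact_mod_cast hab) (Nat.cast_nonneg N))

/-- The grid point of index `0` is `0` (plumbing). [folklore] -/
private theorem gridPt_zero (N : ℕ) : gridPt N 0 = 0 := by
  apply Subtype.ext
  change min (((0 : ℕ) : ℝ) / N) 1 = ((0 : I) : ℝ)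
  rw [Set.Icc.coe_zero, Nat.cast_zero, zero_div, min_eq_left zero_le_one]

/-- The grid point of index `N` is `1` (plumbing). [folklore] -/
private theorem gridPt_self {N : ℕ} (hN : 0 < N) : gridPt N N = 1 := by
  apply Subtype.ext
  rw [coe_gridPt_of_le hN le_rfl, Set.Icc.coe_one, div_self]
  exact_mod_cast hN.ne'

/-- Every point of `[0,1]` is below `1` (plumbing). [folklore] -/
private theorem le_one' (x : I) : x ≤ 1 :=
  Subtype.coe_le_coe.1 (by rw [Set.Icc.coe_one]; exact x.2.2)

/-- Every point of `[0,1]` is above `0` (plumbing). [folklore] -/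
private theorem zero_le' (x : I) : 0 ≤ x :=
  Subtype.coe_le_coe.1 (by rw [Set.Icc.coe_zero]; exact x.2.1)

/-- The lower corner of the cell of `x` is below `x` (plumbing, from the square). [folklore] -/
private theorem gridPt_cellIdx_le (x : I) : gridPt (m + 1) (cellIdx m x) ≤ x :=
  (loCorner_le (m := m) (x, x)).1

/-- `x` is below the upper corner of its cell (plumbing, from the square). [folklore] -/
private theorem le_gridPt_cellIdx_succ (x : I) : x ≤ gridPt (m + 1) ((cellIdx m x : ℕ) + 1) :=
  (le_hiCorner (m := m) (x, x)).1

/-- The cell index is monotone (plumbing, from the square). [folklore] -/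
private theorem cellIdx_mono' : Monotone (cellIdx m) := fun x y h =>
  (cellPair_mono m (show ((x, x) : I × I) ≤ (y, y) from ⟨h, h⟩)).1

/-- The cell index is measurable (plumbing, from the square). [folklore] -/
private theorem measurable_cellIdx' : Measurable (cellIdx m) := by
  have h : Measurable fun x : I => (cellPair m (x, x)).1 :=
    measurable_fst.comp ((cellPair_measurable m).comp (measurable_id.prodMk measurable_id))
  exact h

/-- Every cell of `[0,1]` has length `1/(m+1)` (plumbing, from the area `1/(m+1)²` of the square cells).
[folklore] -/
private theorem volume_cellIdx_preimage (k : Fin (m + 1)) :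
    volume (cellIdx m ⁻¹' {k}) = ENNReal.ofReal (1 / ((m : ℝ) + 1)) := by
  set v := volume (cellIdx m ⁻¹' {k}) with hv
  have hfin : v ≠ ⊤ := measure_ne_top _ _
  have hprod : volume (cellPair m ⁻¹' {(k, k)}) = v * v := by
    have hset : cellPair m ⁻¹' {(k, k)} = (cellIdx m ⁻¹' {k}) ×ˢ (cellIdx m ⁻¹' {k}) := by
      ext p
      simp only [Set.mem_preimage, Set.mem_singleton_iff, Set.mem_prod, cellPair, Prod.ext_iff]
    rw [hset, Measure.volume_eq_prod, Measure.prod_prod]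
  have hreal : (v * v).toReal = (1 / ((m : ℝ) + 1)) ^ 2 := by
    rw [← hprod, ← measureReal_def, volume_real_cell]
    simp only [LiebSahiGrid.gridWeight, Nat.cast_add, Nat.cast_one, one_div_pow]
  have hv2 : v.toReal ^ 2 = (1 / ((m : ℝ) + 1)) ^ 2 := by
    rw [sq, ← ENNReal.toReal_mul, hreal]
  have hvr : v.toReal = 1 / ((m : ℝ) + 1) :=
    (pow_left_inj₀ ENNReal.toReal_nonneg (by positivity) two_ne_zero).1 hv2
  rw [← ENNReal.ofReal_toReal hfin, hvr]

/-! ### The grid of the hypercube `Q_d = (Fin d → [0,1])` -/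

variable {d : ℕ}

/-- The cell of the `(m+1)^d` grid of `Q_d` containing `x` (coordinatewise cell index).
[cite: LiebSahi2021, Lemma 2.3 (proof: "divide `Q_2` uniformly into `m²` little squares")] -/
def cubeCell (m : ℕ) (x : Fin d → I) : Fin d → Fin (m + 1) := fun j => cellIdx m (x j)

/-- The lower corner `(c_j/(m+1))_j` of the cell `c`. [cite: LiebSahi2021, Lemma 2.3 (proof) and §2 (the squares `D_{i,j}`)] -/
def loCube (m : ℕ) (c : Fin d → Fin (m + 1)) : Fin d → I := fun j => gridPt (m + 1) (c j)

/-- The upper corner `((c_j+1)/(m+1))_j` of the cell `c`. [cite: LiebSahi2021, Lemma 2.3 (proof) and §2 (the squares `D_{i,j}`)] -/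
def hiCube (m : ℕ) (c : Fin d → Fin (m + 1)) : Fin d → I := fun j => gridPt (m + 1) ((c j : ℕ) + 1)

/-- The uniform probability weight `(m+1)^{-d}` on the discrete box `[m+1]^d = (Fin d → Fin (m+1))` (written as
`1 / M^d`, `M = m+1`, the form used in `…SahiUniformGrid.lean`). [cite: LiebSahi2021, Lemma 2.3 (proof) and Lemma 2.4] -/
def cubeWeight (d m : ℕ) : (Fin d → Fin (m + 1)) → ℝ := fun _ => (1 : ℝ) / ((m + 1 : ℕ) : ℝ) ^ d

/-- The uniform box weight, numerically. [cite: LiebSahi2021, Lemma 2.3 (proof)] -/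
theorem cubeWeight_apply (c : Fin d → Fin (m + 1)) : cubeWeight d m c = 1 / ((m : ℝ) + 1) ^ d := by
  simp only [cubeWeight, Nat.cast_add, Nat.cast_one]

/-- The uniform box weight is nonnegative. [cite: LiebSahi2021, Lemma 2.4] -/
theorem cubeWeight_nonneg (c : Fin d → Fin (m + 1)) : 0 ≤ cubeWeight d m c := by
  rw [cubeWeight_apply]
  positivity

/-- The uniform box weight has total mass one. [cite: LiebSahi2021, Lemma 2.4] -/
theorem sum_cubeWeight : ∑ c, cubeWeight d m c = 1 := by
  simp only [cubeWeight_apply, sum_const, card_univ, Fintype.card_fun, Fintype.card_fin, nsmul_eq_mul]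
  push_cast
  have hm : (0 : ℝ) < ((m : ℝ) + 1) ^ d := by positivity
  field_simp

/-- `c⁻(x) ≤ x`. [cite: LiebSahi2021, Lemma 2.3 (proof)] -/
theorem loCube_cubeCell_le (x : Fin d → I) : loCube m (cubeCell m x) ≤ x := fun j => gridPt_cellIdx_le (x j)

/-- `x ≤ c⁺(x)`. [cite: LiebSahi2021, Lemma 2.3 (proof)] -/
theorem le_hiCube_cubeCell (x : Fin d → I) : x ≤ hiCube m (cubeCell m x) := fun j =>
  le_gridPt_cellIdx_succ (x j)

/-- The lower corner is below the upper corner. [cite: LiebSahi2021, Lemma 2.3 (proof)] -/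
theorem loCube_le_hiCube (c : Fin d → Fin (m + 1)) : loCube m c ≤ hiCube m c := fun j =>
  gridPt_mono (m + 1) (Nat.le_succ (c j : ℕ))

/-- The lower-corner map is monotone in the cell. [cite: LiebSahi2021, Lemma 2.3 (proof)] -/
theorem loCube_mono (m : ℕ) : Monotone (loCube (d := d) m) := fun _ _ h j => gridPt_mono (m + 1) (h j)

/-- The cell map is monotone. [cite: LiebSahi2021, Lemma 2.3 (proof)] -/
theorem cubeCell_mono (m : ℕ) : Monotone (cubeCell (d := d) m) := fun _ _ h j => cellIdx_mono' (h j)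

/-- The cell map is measurable. [cite: LiebSahi2021, Lemma 2.3 (proof)] -/
theorem measurable_cubeCell (m : ℕ) : Measurable (cubeCell (d := d) m) :=
  measurable_pi_lambda _ fun j => measurable_cellIdx'.comp (measurable_pi_apply j)

/-- Every point is below the top corner `(1,…,1)` (plumbing). [folklore] -/
private theorem le_top' (x : Fin d → I) : x ≤ fun _ => 1 := fun j => le_one' (x j)

/-- Every point is above the bottom corner `(0,…,0)` (plumbing). [folklore] -/
private theorem bot_le' (x : Fin d → I) : (fun _ => (0 : I)) ≤ x := fun j => zero_le' (x j)

/-- **Every cell of the hypercube has Lebesgue volume `(m+1)^{-d}`**, the uniform box weight.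
[cite: LiebSahi2021, Lemma 2.3 (proof)] -/
theorem volume_real_cubeCell_preimage (c : Fin d → Fin (m + 1)) :
    volume.real (cubeCell m ⁻¹' {c}) = cubeWeight d m c := by
  have hset : cubeCell m ⁻¹' {c} = Set.pi Set.univ fun j => cellIdx m ⁻¹' {c j} := by
    ext x
    simp only [Set.mem_preimage, Set.mem_singleton_iff, Set.mem_univ_pi, funext_iff, cubeCell]
  rw [measureReal_def, hset, volume_pi_pi]
  simp only [volume_cellIdx_preimage, prod_const, card_univ, Fintype.card_fin]
  rw [← ENNReal.ofReal_pow (by positivity), ENNReal.toReal_ofReal (by positivity), cubeWeight_apply,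
    one_div_pow]

/-- **Integral of a grid step function** = its expectation under the uniform box weight:
`∫ γ(cell(x)) dx = (m+1)^{-d} Σ_c γ(c)`. [cite: LiebSahi2021, Lemma 2.3 (proof)] -/
theorem integral_comp_cubeCell (γ : (Fin d → Fin (m + 1)) → ℝ) :
    ∫ x, γ (cubeCell m x) ∂volume = ex (cubeWeight d m) γ := by
  have hγ : AEStronglyMeasurable γ (volume.map (cubeCell (d := d) m)) :=
    (measurable_of_countable γ).aestronglyMeasurable
  rw [← integral_map (measurable_cubeCell m).aemeasurable hγ,
    integral_fintype (Integrable.of_finite (μ := volume.map (cubeCell (d := d) m)) (f := γ)), ex]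
  refine sum_congr rfl fun c _ => ?_
  rw [map_measureReal_apply (measurable_cubeCell m) (measurableSet_singleton c),
    volume_real_cubeCell_preimage, smul_eq_mul]

/-- A grid step function is integrable (plumbing). [folklore] -/
private theorem integrable_comp_cubeCell (γ : (Fin d → Fin (m + 1)) → ℝ) :
    Integrable (fun x => γ (cubeCell m x)) (volume : Measure (Fin d → I)) :=
  (Integrable.of_finite (μ := volume.map (cubeCell (d := d) m)) (f := γ)).comp_measurable
    (measurable_cubeCell m)

/-! ### Lower and upper Riemann sums of a monotone function on `Q_d` -/

/-- The lower grid sum `L_m(g) = (m+1)^{-d} Σ_c g(c⁻)`. [cite: LiebSahi2021, Lemma 2.3 (proof)] -/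
def lowerSum (m : ℕ) (g : (Fin d → I) → ℝ) : ℝ := ex (cubeWeight d m) (g ∘ loCube m)

/-- The upper grid sum `U_m(g) = (m+1)^{-d} Σ_c g(c⁺)`. [cite: LiebSahi2021, Lemma 2.3 (proof)] -/
def upperSum (m : ℕ) (g : (Fin d → I) → ℝ) : ℝ := ex (cubeWeight d m) (g ∘ hiCube m)

/-- **Lower sandwich**: `L_m(g) ≤ ∫ g` for a monotone integrable `g`. [cite: LiebSahi2021, Lemma 2.3 (proof)] -/
theorem lowerSum_le_integral {g : (Fin d → I) → ℝ} (hg : Monotone g) (hgi : Integrable g volume) :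
    lowerSum m g ≤ ∫ x, g x ∂volume := by
  rw [lowerSum, ← integral_comp_cubeCell]
  exact integral_mono (integrable_comp_cubeCell _) hgi fun x => hg (loCube_cubeCell_le x)

/-- **Upper sandwich**: `∫ g ≤ U_m(g)` for a monotone integrable `g`. [cite: LiebSahi2021, Lemma 2.3 (proof)] -/
theorem integral_le_upperSum {g : (Fin d → I) → ℝ} (hg : Monotone g) (hgi : Integrable g volume) :
    ∫ x, g x ∂volume ≤ upperSum m g := by
  rw [upperSum, ← integral_comp_cubeCell]
  exact integral_mono hgi (integrable_comp_cubeCell _) fun x => hg (le_hiCube_cubeCell x)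

/-- The upper corner of a cell `(a, c')` of `Q_{d+1}` splits off its first coordinate (plumbing). [folklore] -/
private theorem hiCube_cons (a : Fin (m + 1)) (c : Fin d → Fin (m + 1)) :
    hiCube m (Fin.cons a c : Fin (d + 1) → Fin (m + 1)) =
      Fin.cons (gridPt (m + 1) ((a : ℕ) + 1)) (hiCube m c) := by
  funext j
  refine Fin.cases ?_ (fun i => ?_) j
  · simp only [hiCube, Fin.cons_zero]
  · simp only [hiCube, Fin.cons_succ]

/-- The lower corner of a cell `(a, c')` of `Q_{d+1}` splits off its first coordinate (plumbing). [folklore] -/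
private theorem loCube_cons (a : Fin (m + 1)) (c : Fin d → Fin (m + 1)) :
    loCube m (Fin.cons a c : Fin (d + 1) → Fin (m + 1)) = Fin.cons (gridPt (m + 1) a) (loCube m c) := by
  funext j
  refine Fin.cases ?_ (fun i => ?_) j
  · simp only [loCube, Fin.cons_zero]
  · simp only [loCube, Fin.cons_succ]

/-- **Coordinatewise telescoping** (the heart of the sandwich): for a monotone `g` on `Q_d`,
`(m+1) · Σ_c (g(c⁺) − g(c⁻)) ≤ d · (m+1)^d · (g(1,…,1) − g(0,…,0))` — i.e. the boundary cells of a monotone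
staircase number `O(d (m+1)^{d−1})` out of `(m+1)^d`.  By induction on `d`: split the difference across the cell
into the step in the first coordinate (which telescopes along each row) and the step in the remaining ones.
[cite: LiebSahi2021, Lemma 2.3 (proof)] -/
theorem sum_gap_mul_le (m : ℕ) : ∀ (d : ℕ) (g : (Fin d → I) → ℝ), Monotone g →
    (∑ c : Fin d → Fin (m + 1), (g (hiCube m c) - g (loCube m c))) * ((m : ℝ) + 1) ≤
      (d : ℝ) * ((m : ℝ) + 1) ^ d * (g (fun _ => 1) - g (fun _ => 0))
  | 0, g, _ => by
      have h0 : ∀ c : Fin 0 → Fin (m + 1), g (hiCube m c) - g (loCube m c) = 0 := fun c => by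
        rw [Subsingleton.elim (hiCube m c) (loCube m c), sub_self]
      simp only [h0, sum_const_zero, zero_mul, Nat.cast_zero, le_refl]
  | d + 1, g, hg => by
      set T : ℝ := (m : ℝ) + 1 with hT
      set B : ℝ := g (fun _ => 1) - g (fun _ => 0) with hB
      have hT0 : 0 < T := by positivity
      set p : ℕ → I := gridPt (m + 1) with hp
      -- the row functions and the first-coordinate sections
      set G : (Fin d → Fin (m + 1)) → ℕ → ℝ := fun c' b => g (Fin.cons (p b) (loCube m c')) with hG
      set h : Fin (m + 1) → (Fin d → I) → ℝ := fun a x' => g (Fin.cons (p ((a : ℕ) + 1)) x') with hh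
      have hmono_h : ∀ a, Monotone (h a) := fun a x y hxy =>
        hg (Fin.cons_le_cons.2 ⟨le_rfl, hxy⟩)
      have hB_h : ∀ a, h a (fun _ => 1) - h a (fun _ => 0) ≤ B := fun a =>
        sub_le_sub (hg (le_top' _)) (hg (bot_le' _))
      have hmono_G : ∀ c', Monotone (G c') := fun c' b b' hbb' =>
        hg (Fin.cons_le_cons.2 ⟨gridPt_mono _ hbb', le_rfl⟩)
      have hB_G : ∀ c', G c' (m + 1) - G c' 0 ≤ B := fun c' =>
        sub_le_sub (hg (le_top' _)) (hg (bot_le' _))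
      -- rewrite the sum over cells of `Q_{d+1}` as a double sum
      have hS : (∑ c : Fin (d + 1) → Fin (m + 1), (g (hiCube m c) - g (loCube m c))) =
          ∑ a : Fin (m + 1), ∑ c' : Fin d → Fin (m + 1),
            ((h a (hiCube m c') - h a (loCube m c')) + (G c' ((a : ℕ) + 1) - G c' a)) := by
        rw [← Fintype.sum_prod_type']
        refine Fintype.sum_equiv (Fin.consEquiv fun _ => Fin (m + 1)).symm _ _ fun c => ?_
        simp only [Fin.consEquiv_symm_apply, hh, hG]
        conv_lhs => rw [← Fin.cons_self_tail c]
        rw [hiCube_cons, loCube_cons]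
        ring
      have h1 : ∀ a : Fin (m + 1),
          (∑ c' : Fin d → Fin (m + 1), (h a (hiCube m c') - h a (loCube m c'))) * T ≤ (d : ℝ) * T ^ d * B := by
        intro a
        refine (sum_gap_mul_le m d (h a) (hmono_h a)).trans ?_
        exact mul_le_mul_of_nonneg_left (hB_h a) (by positivity)
      have h2 : ∀ c' : Fin d → Fin (m + 1),
          ∑ a : Fin (m + 1), (G c' ((a : ℕ) + 1) - G c' a) ≤ B := by
        intro c'
        rw [Fin.sum_univ_eq_sum_range (fun b => G c' (b + 1) - G c' b) (m + 1), Finset.sum_range_sub]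
        exact hB_G c'
      have hS1 : (∑ a : Fin (m + 1), ∑ c' : Fin d → Fin (m + 1), (h a (hiCube m c') - h a (loCube m c'))) * T ≤
          (d : ℝ) * T ^ (d + 1) * B := by
        rw [sum_mul]
        calc ∑ a : Fin (m + 1), (∑ c' : Fin d → Fin (m + 1), (h a (hiCube m c') - h a (loCube m c'))) * T
            ≤ ∑ _a : Fin (m + 1), (d : ℝ) * T ^ d * B := sum_le_sum fun a _ => h1 a
          _ = (d : ℝ) * T ^ (d + 1) * B := by
              rw [sum_const, card_univ, Fintype.card_fin, nsmul_eq_mul]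
              push_cast
              ring
      have hS2 : (∑ a : Fin (m + 1), ∑ c' : Fin d → Fin (m + 1), (G c' ((a : ℕ) + 1) - G c' a)) * T ≤
          T ^ (d + 1) * B := by
        rw [sum_comm]
        have hle : ∑ c' : Fin d → Fin (m + 1), ∑ a : Fin (m + 1), (G c' ((a : ℕ) + 1) - G c' a) ≤
            T ^ d * B := by
          calc ∑ c' : Fin d → Fin (m + 1), ∑ a : Fin (m + 1), (G c' ((a : ℕ) + 1) - G c' a)
              ≤ ∑ _c' : Fin d → Fin (m + 1), B := sum_le_sum fun c' _ => h2 c'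
            _ = T ^ d * B := by
                rw [sum_const, card_univ, Fintype.card_fun, Fintype.card_fin, Fintype.card_fin, nsmul_eq_mul]
                push_cast
                ring
        calc (∑ c' : Fin d → Fin (m + 1), ∑ a : Fin (m + 1), (G c' ((a : ℕ) + 1) - G c' a)) * T
            ≤ T ^ d * B * T := mul_le_mul_of_nonneg_right hle hT0.le
          _ = T ^ (d + 1) * B := by ring
      rw [hS]
      simp only [sum_add_distrib]
      rw [add_mul]
      calc (∑ a : Fin (m + 1), ∑ c' : Fin d → Fin (m + 1), (h a (hiCube m c') - h a (loCube m c'))) * T +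
            (∑ a : Fin (m + 1), ∑ c' : Fin d → Fin (m + 1), (G c' ((a : ℕ) + 1) - G c' a)) * T
          ≤ (d : ℝ) * T ^ (d + 1) * B + T ^ (d + 1) * B := add_le_add hS1 hS2
        _ = ((d + 1 : ℕ) : ℝ) * T ^ (d + 1) * B := by push_cast; ring

/-- **The sandwich closes**: `U_m(g) − L_m(g) ≤ d · (g(1,…,1) − g(0,…,0)) / (m+1)` for a monotone `g` on `Q_d`.
[cite: LiebSahi2021, Lemma 2.3 (proof)] -/
theorem upperSum_sub_lowerSum_le {g : (Fin d → I) → ℝ} (hg : Monotone g) (m : ℕ) :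
    upperSum m g - lowerSum m g ≤ (d : ℝ) * (g (fun _ => 1) - g (fun _ => 0)) / ((m : ℝ) + 1) := by
  have hT : (0 : ℝ) < (m : ℝ) + 1 := by positivity
  have hdiff : upperSum m g - lowerSum m g =
      (∑ c : Fin d → Fin (m + 1), (g (hiCube m c) - g (loCube m c))) / ((m : ℝ) + 1) ^ d := by
    rw [upperSum, lowerSum, ex, ex, ← sum_sub_distrib, sum_div]
    refine sum_congr rfl fun c _ => ?_
    simp only [cubeWeight_apply, Function.comp_apply]
    ring
  rw [hdiff, div_le_div_iff₀ (by positivity) hT]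
  calc (∑ c : Fin d → Fin (m + 1), (g (hiCube m c) - g (loCube m c))) * ((m : ℝ) + 1)
      ≤ (d : ℝ) * ((m : ℝ) + 1) ^ d * (g (fun _ => 1) - g (fun _ => 0)) := sum_gap_mul_le m d g hg
    _ = (d : ℝ) * (g (fun _ => 1) - g (fun _ => 0)) * ((m : ℝ) + 1) ^ d := by ring

/-! ### Monotone functions on the hypercube are a.e. Borel -/

/-- **A monotone function on `Q_d` is a.e. strongly measurable for Lebesgue measure** (squeezed between the
Borel functions `sup_m g ∘ c⁻_m ≤ g ≤ inf_m g ∘ c⁺_m`, whose difference has integral `≤ d(g(1) − g(0))/(m+1)` for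
every `m`, hence vanishes a.e.). [cite: LiebSahi2021, Lemma 2.3 (proof)] -/
theorem _root_.Monotone.aestronglyMeasurable_unitCube {g : (Fin d → I) → ℝ} (hg : Monotone g) :
    AEStronglyMeasurable g (volume : Measure (Fin d → I)) := by
  set s : ℕ → (Fin d → I) → ℝ := fun m x => g (loCube m (cubeCell m x)) with hs
  set t : ℕ → (Fin d → I) → ℝ := fun m x => g (hiCube m (cubeCell m x)) with ht
  have hs_le : ∀ m x, s m x ≤ g x := fun m x => hg (loCube_cubeCell_le x)
  have hle_t : ∀ m x, g x ≤ t m x := fun m x => hg (le_hiCube_cubeCell x)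
  have hs_meas : ∀ m, Measurable (s m) := fun m =>
    (measurable_of_countable (g ∘ loCube m)).comp (measurable_cubeCell m)
  have ht_meas : ∀ m, Measurable (t m) := fun m =>
    (measurable_of_countable (g ∘ hiCube m)).comp (measurable_cubeCell m)
  set l : (Fin d → I) → ℝ := fun x => ⨆ m, s m x with hl
  set u : (Fin d → I) → ℝ := fun x => ⨅ m, t m x with hu
  have hl_meas : Measurable l := Measurable.iSup hs_meas
  have hu_meas : Measurable u := Measurable.iInf ht_meas
  have hbdd_s : ∀ x, BddAbove (Set.range fun m => s m x) := fun x => ⟨g x, by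
    rintro _ ⟨m, rfl⟩; exact hs_le m x⟩
  have hbdd_t : ∀ x, BddBelow (Set.range fun m => t m x) := fun x => ⟨g x, by
    rintro _ ⟨m, rfl⟩; exact hle_t m x⟩
  have hl_le : ∀ x, l x ≤ g x := fun x => ciSup_le fun m => hs_le m x
  have hle_u : ∀ x, g x ≤ u x := fun x => le_ciInf fun m => hle_t m x
  have hs_le_l : ∀ m x, s m x ≤ l x := fun m x => le_ciSup (hbdd_s x) m
  have hu_le_t : ∀ m x, u x ≤ t m x := fun m x => ciInf_le (hbdd_t x) m
  set B : ℝ := g (fun _ => 1) - g (fun _ => 0) with hB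
  have hgap_nonneg : ∀ x, 0 ≤ u x - l x := fun x => sub_nonneg.2 ((hl_le x).trans (hle_u x))
  have hgap_le : ∀ m x, u x - l x ≤ t m x - s m x := fun m x => sub_le_sub (hu_le_t m x) (hs_le_l m x)
  have hts_le : ∀ m x, t m x - s m x ≤ B := fun m x => sub_le_sub (hg (le_top' _)) (hg (bot_le' _))
  have hgap_int : Integrable (fun x => u x - l x) volume := by
    refine Integrable.mono' (integrable_const B) (hu_meas.sub hl_meas).aestronglyMeasurable
      (Eventually.of_forall fun x => ?_)
    rw [Real.norm_eq_abs, abs_of_nonneg (hgap_nonneg x)]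
    exact (hgap_le 0 x).trans (hts_le 0 x)
  have hint_le : ∀ m : ℕ, ∫ x, (u x - l x) ∂volume ≤ (d : ℝ) * B / ((m : ℝ) + 1) := by
    intro m
    have i1 : Integrable (fun x => t m x) volume := integrable_comp_cubeCell (g ∘ hiCube m)
    have i2 : Integrable (fun x => s m x) volume := integrable_comp_cubeCell (g ∘ loCube m)
    have e1 : ∫ x, t m x ∂volume = upperSum m g := integral_comp_cubeCell (g ∘ hiCube m)
    have e2 : ∫ x, s m x ∂volume = lowerSum m g := integral_comp_cubeCell (g ∘ loCube m)
    have e : ∫ x, (t m x - s m x) ∂volume = (∫ x, t m x ∂volume) - ∫ x, s m x ∂volume := integral_sub i1 i2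
    calc ∫ x, (u x - l x) ∂volume ≤ ∫ x, (t m x - s m x) ∂volume :=
          integral_mono hgap_int (i1.sub i2) fun x => hgap_le m x
      _ = upperSum m g - lowerSum m g := by rw [e, e1, e2]
      _ ≤ (d : ℝ) * B / ((m : ℝ) + 1) := upperSum_sub_lowerSum_le hg m
  have hint_zero : ∫ x, (u x - l x) ∂volume = 0 := by
    refine le_antisymm ?_ (integral_nonneg fun x => hgap_nonneg x)
    have hlim : Tendsto (fun m : ℕ => (d : ℝ) * B / ((m : ℝ) + 1)) atTop (𝓝 0) := by
      have h := (tendsto_const_div_atTop_nhds_zero_nat ((d : ℝ) * B)).comp (tendsto_add_atTop_nat 1)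
      refine h.congr fun m => ?_
      simp only [Function.comp_apply, Nat.cast_add, Nat.cast_one]
    exact ge_of_tendsto' hlim hint_le
  have hae : (fun x => u x - l x) =ᵐ[volume] 0 :=
    (integral_eq_zero_iff_of_nonneg (fun x => hgap_nonneg x) hgap_int).1 hint_zero
  have hgl : g =ᵐ[volume] l := by
    filter_upwards [hae] with x hx
    have hx' : u x = l x := by
      have := hx; simp only [Pi.zero_apply] at this; linarith
    exact le_antisymm ((hle_u x).trans hx'.le) (hl_le x)
  exact (hl_meas.aestronglyMeasurable).congr hgl.symm

/-- **A monotone function on `Q_d` is integrable for Lebesgue measure** (bounded by its values at the corners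
`(0,…,0)` and `(1,…,1)`, a.e. Borel). [cite: LiebSahi2021, §2 (setting: positive monotone functions on `Q_k`)] -/
theorem _root_.Monotone.integrable_unitCube {g : (Fin d → I) → ℝ} (hg : Monotone g) :
    Integrable g (volume : Measure (Fin d → I)) := by
  refine Integrable.mono' (integrable_const (|g fun _ => 0| + |g fun _ => 1|)) hg.aestronglyMeasurable_unitCube
    (Eventually.of_forall fun x => ?_)
  rw [Real.norm_eq_abs]
  have h1 := hg (bot_le' x)
  have h2 := hg (le_top' x)
  rcases le_total 0 (g x) with h | h
  · rw [abs_of_nonneg h]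
    linarith [le_abs_self (g fun _ => 1), abs_nonneg (g fun _ => 0)]
  · rw [abs_of_nonpos h]
    linarith [neg_abs_le (g fun _ => 0), abs_nonneg (g fun _ => 1)]

/-! ### Joint moments: uniform boxes versus Lebesgue measure -/

variable {n : ℕ}

/-- The grid family of level `m`: `c ↦ f_i(c/(m+1))` on the box `[m+1]^d` (values at the lower corners).
[cite: LiebSahi2021, Lemma 2.3 / Lemma 3.8] -/
def gridFam (m : ℕ) (f : Fin n → (Fin d → I) → ℝ) (i : Fin n) : (Fin d → Fin (m + 1)) → ℝ :=
  f i ∘ loCube m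

/-- The grid family is nonnegative if `f` is. [cite: LiebSahi2021, Lemma 3.8] -/
theorem gridFam_nonneg {f : Fin n → (Fin d → I) → ℝ} (hf0 : ∀ i x, 0 ≤ f i x) (m : ℕ) :
    ∀ i c, 0 ≤ gridFam m f i c := fun i _ => hf0 i _

/-- The grid family is monotone if `f` is. [cite: LiebSahi2021, Lemma 3.8] -/
theorem gridFam_monotone {f : Fin n → (Fin d → I) → ℝ} (hmono : ∀ i, Monotone (f i)) (m : ℕ) :
    ∀ i, Monotone (gridFam m f i) := fun i => (hmono i).comp (loCube_mono m)

/-- A finite product of nonnegative monotone real functions is monotone (plumbing). [folklore] -/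
private theorem monotone_finset_prod {β : Type*} [Preorder β] {f : Fin n → β → ℝ} (hf0 : ∀ i x, 0 ≤ f i x)
    (hmono : ∀ i, Monotone (f i)) (S : Finset (Fin n)) : Monotone (∏ i ∈ S, f i) := by
  classical
  induction S using Finset.induction_on with
  | empty =>
    rw [Finset.prod_empty]
    exact monotone_const
  | insert a S ha ih =>
    rw [Finset.prod_insert ha]
    exact (hmono a).mul ih (hf0 a) fun x => by
      rw [Finset.prod_apply]; exact prod_nonneg fun i _ => hf0 i x

/-- **The joint moments of the grid family converge to those of `f`**:
`E_box(Π_{i∈S} f_i ∘ c⁻) → ∫ Π_{i∈S} f_i` as the mesh `1/(m+1) → 0` (the `L¹` limit of Lemma 2.3 / 3.8 in moment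
form, dimension `d`). [cite: LiebSahi2021, Lemma 2.3 and Lemma 3.8] -/
theorem tendsto_gridMoment {f : Fin n → (Fin d → I) → ℝ} (hf0 : ∀ i x, 0 ≤ f i x)
    (hmono : ∀ i, Monotone (f i)) (S : Finset (Fin n)) :
    Tendsto (fun m => ex (cubeWeight d m) (∏ i ∈ S, gridFam m f i)) atTop
      (𝓝 (∫ x, (∏ i ∈ S, f i) x ∂volume)) := by
  set g : (Fin d → I) → ℝ := ∏ i ∈ S, f i with hgdef
  have hg : Monotone g := monotone_finset_prod hf0 hmono S
  have hgi : Integrable g volume := hg.integrable_unitCube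
  have hlo : ∀ m, ex (cubeWeight d m) (∏ i ∈ S, gridFam m f i) = lowerSum m g := by
    intro m
    rw [lowerSum]
    congr 1
    funext c
    simp only [Finset.prod_apply, Function.comp_apply, gridFam, hgdef]
  simp only [hlo]
  set B : ℝ := g (fun _ => 1) - g (fun _ => 0) with hB
  have hlim0 : Tendsto (fun m : ℕ => (∫ x, g x ∂volume) - (d : ℝ) * B / ((m : ℝ) + 1)) atTop
      (𝓝 (∫ x, g x ∂volume)) := by
    have h := (tendsto_const_div_atTop_nhds_zero_nat ((d : ℝ) * B)).comp (tendsto_add_atTop_nat 1)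
    have h' : Tendsto (fun m : ℕ => (d : ℝ) * B / ((m : ℝ) + 1)) atTop (𝓝 0) := by
      refine h.congr fun m => ?_
      simp only [Function.comp_apply, Nat.cast_add, Nat.cast_one]
    simpa using (tendsto_const_nhds (x := ∫ x, g x ∂volume)).sub h'
  refine tendsto_of_tendsto_of_tendsto_of_le_of_le hlim0 tendsto_const_nhds (fun m => ?_) fun m => ?_
  · have h1 := integral_le_upperSum (m := m) hg hgi
    have h2 := upperSum_sub_lowerSum_le hg m
    linarith
  · exact lowerSum_le_integral hg hgi

/-! ### Lebesgue measure on `Q_d` versus the uniform boxes `[M]^d` -/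

/-- **Lieb–Sahi's Lemma 3.8 in dimension `d`**: if the uniform weight on every box `[m+1]^d` is Sahi-positive
of order `n`, then `E_n(f_0,…,f_{n−1}) ≥ 0` for Lebesgue measure on `Q_d` and all nonnegative monotone
increasing `f_i : Q_d → ℝ` — "it suffices to prove it for the grid functions, for all `m`".  Proof: `E_n` is the
moment polynomial at the joint moments (`msahiE_eq_momentE`), the Lebesgue joint moments are limits of the box
moments (`tendsto_gridMoment`), and the polynomial is continuous (`continuous_momentE`).
[cite: LiebSahi2021, Lemma 3.8 (with Lemma 2.3)] -/
theorem msahiE_volume_nonneg_of_cubeWeight (n : ℕ) (hU : ∀ m : ℕ, SahiPositive (cubeWeight d m) n)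
    (f : Fin n → (Fin d → I) → ℝ) (hf0 : ∀ i x, 0 ≤ f i x) (hmono : ∀ i, Monotone (f i)) :
    0 ≤ msahiE (volume : Measure (Fin d → I)) n f := by
  set M : Finset (Fin n) → ℝ := fun S => ∫ x, (∏ i ∈ S, f i) x ∂volume with hM
  have hE : msahiE (volume : Measure (Fin d → I)) n f = momentE n M := msahiE_eq_momentE _ n f
  have hlim : Tendsto (fun m => momentE n fun S => ex (cubeWeight d m) (∏ i ∈ S, gridFam m f i))
      atTop (𝓝 (momentE n M)) :=
    ((continuous_momentE n).tendsto M).comp (tendsto_pi_nhds.2 fun S => tendsto_gridMoment hf0 hmono S)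
  have hpos : ∀ m, 0 ≤ momentE n fun S => ex (cubeWeight d m) (∏ i ∈ S, gridFam m f i) := by
    intro m
    rw [← sahiE_eq_momentE]
    exact hU m _ (gridFam_nonneg hf0 m) (gridFam_monotone hmono m)
  rw [hE]
  exact ge_of_tendsto' hlim hpos

/-- **A monotone family on the box is a grid step family of Lebesgue measure**: for `h_i : [m+1]^d → ℝ`,
`E_n^{box}(h) = E_n^{Leb}(h_0 ∘ cell,…,h_{n−1} ∘ cell)` (all joint moments agree, `integral_comp_cubeCell`).
[cite: LiebSahi2021, Lemma 2.3 (proof: the step functions `χ_{S^m}`)] -/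
theorem sahiE_cubeWeight_eq_msahiE (n : ℕ) (h : Fin n → (Fin d → Fin (m + 1)) → ℝ) :
    sahiE (cubeWeight d m) n h = msahiE (volume : Measure (Fin d → I)) n (fun i => h i ∘ cubeCell m) := by
  symm
  refine msahiE_eq_sahiE_of_moments _ _ _ _ fun S => ?_
  have hS : (∏ i ∈ S, (h i ∘ cubeCell m)) = (∏ i ∈ S, h i) ∘ cubeCell (d := d) m := by
    funext x
    simp only [Finset.prod_apply, Function.comp_apply]
  rw [hS]
  exact integral_comp_cubeCell _

/-- **Sahi positivity descends from Lebesgue measure on `Q_d` to every uniform box `[m+1]^d`** (pull the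
monotone family back along the monotone cell map). [cite: LiebSahi2021, Lemma 2.3 (proof)] -/
theorem sahiPositive_cubeWeight_of_mSahiPositive {n : ℕ} (h : MSahiPositive (volume : Measure (Fin d → I)) n)
    (m : ℕ) : SahiPositive (cubeWeight d m) n := fun f hf hmono => by
  rw [sahiE_cubeWeight_eq_msahiE]
  exact h _ (fun i x => hf i _) fun i => (hmono i).comp (cubeCell_mono m)

/-- **Lebesgue measure on `Q_d` is Sahi-positive of order `n` iff the uniform weight on every box `[m+1]^d`
is.** [cite: LiebSahi2021, Lemma 3.8 (with Lemma 2.3)] -/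
theorem mSahiPositive_volume_iff_cubeWeight (d n : ℕ) :
    MSahiPositive (volume : Measure (Fin d → I)) n ↔ ∀ m : ℕ, SahiPositive (cubeWeight d m) n :=
  ⟨fun h m => sahiPositive_cubeWeight_of_mSahiPositive h m,
    fun hU f hf0 hmono => msahiE_volume_nonneg_of_cubeWeight n hU f hf0 hmono⟩

/-- **The same, with the uniform boxes written as in the tree's width stratification**
(`Summits/…/…SahiUniformGrid.lean`, layer `U(d,n)`): Lebesgue measure on `Q_d` is Sahi-positive of order `n`
iff for every `M ≥ 1` the uniform probability weight `1/M^d` on `[M]^d = (Fin d → Fin M)` is.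
[cite: LiebSahi2021, Lemma 3.8 (with Lemma 2.3)] -/
theorem mSahiPositive_volume_iff_uniformGrid (d n : ℕ) :
    MSahiPositive (volume : Measure (Fin d → I)) n ↔
      ∀ M : ℕ, 0 < M → SahiPositive (fun _ : Fin d → Fin M => (1 : ℝ) / (M : ℝ) ^ d) n := by
  rw [mSahiPositive_volume_iff_cubeWeight]
  constructor
  · intro h M hM
    obtain ⟨m, rfl⟩ := Nat.exists_eq_succ_of_ne_zero hM.ne'
    exact h m
  · intro h m
    exact h (m + 1) (Nat.succ_pos m)

end LebesgueCube

open LebesgueCube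

/-- **Lieb–Sahi's discretisation, packaged**: for every dimension `d` and order `n`, `E_n ≥ 0` holds for all
nonnegative monotone increasing families on `Q_d` with Lebesgue measure as soon as it holds for the uniform
weight on every discrete box `[m+1]^d`. [cite: LiebSahi2021, Lemma 3.8 (with Lemma 2.3)] -/
theorem mSahiPositive_volume_unitCube_of_uniformGrid {d n : ℕ}
    (hU : ∀ m : ℕ, SahiPositive (cubeWeight d m) n) : MSahiPositive (volume : Measure (Fin d → I)) n :=
  (mSahiPositive_volume_iff_cubeWeight d n).2 hU

/-! ### Monotone functions on `Q_d` are a.e. equal to monotone BOREL functions (appended 2026-08-20, typer gen 6) -/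

namespace LebesgueCube

variable {d : ℕ}

/-- **A monotone function on `Q_d` agrees a.e. (Lebesgue) with a monotone Borel function below it**: the lower
grid regularisation `l = sup_m g ∘ c⁻_{m}` of the proof of `Monotone.aestronglyMeasurable_unitCube` is itself
monotone, Borel, squeezed between `g(0,…,0)` and `g`, and `g = l` a.e.  (So every statement about `E_n` of
monotone families for Lebesgue measure may assume the families Borel.) [cite: LiebSahi2021, Lemma 2.3 (proof)] -/
theorem _root_.Monotone.exists_measurable_monotone_ae_eq_unitCube {g : (Fin d → I) → ℝ} (hg : Monotone g) :
    ∃ l : (Fin d → I) → ℝ, Measurable l ∧ Monotone l ∧ (∀ x, l x ≤ g x) ∧ (∀ x, g (fun _ => 0) ≤ l x) ∧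
      g =ᵐ[volume] l := by
  set s : ℕ → (Fin d → I) → ℝ := fun m x => g (loCube m (cubeCell m x)) with hs
  set t : ℕ → (Fin d → I) → ℝ := fun m x => g (hiCube m (cubeCell m x)) with ht
  have hs_le : ∀ m x, s m x ≤ g x := fun m x => hg (loCube_cubeCell_le x)
  have hle_t : ∀ m x, g x ≤ t m x := fun m x => hg (le_hiCube_cubeCell x)
  have hs_mono : ∀ m, Monotone (s m) := fun m x y hxy =>
    hg (loCube_mono m (cubeCell_mono m hxy))
  have hs_meas : ∀ m, Measurable (s m) := fun m =>
    (measurable_of_countable (g ∘ loCube m)).comp (measurable_cubeCell m)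
  have ht_meas : ∀ m, Measurable (t m) := fun m =>
    (measurable_of_countable (g ∘ hiCube m)).comp (measurable_cubeCell m)
  set l : (Fin d → I) → ℝ := fun x => ⨆ m, s m x with hl
  set u : (Fin d → I) → ℝ := fun x => ⨅ m, t m x with hu
  have hl_meas : Measurable l := Measurable.iSup hs_meas
  have hu_meas : Measurable u := Measurable.iInf ht_meas
  have hbdd_s : ∀ x, BddAbove (Set.range fun m => s m x) := fun x => ⟨g x, by
    rintro _ ⟨m, rfl⟩; exact hs_le m x⟩
  have hbdd_t : ∀ x, BddBelow (Set.range fun m => t m x) := fun x => ⟨g x, by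
    rintro _ ⟨m, rfl⟩; exact hle_t m x⟩
  have hl_le : ∀ x, l x ≤ g x := fun x => ciSup_le fun m => hs_le m x
  have hle_u : ∀ x, g x ≤ u x := fun x => le_ciInf fun m => hle_t m x
  have hs_le_l : ∀ m x, s m x ≤ l x := fun m x => le_ciSup (hbdd_s x) m
  have hu_le_t : ∀ m x, u x ≤ t m x := fun m x => ciInf_le (hbdd_t x) m
  have hl_mono : Monotone l := fun x y hxy => ciSup_mono (hbdd_s y) fun m => hs_mono m hxy
  have hl_low : ∀ x, g (fun _ => 0) ≤ l x := fun x => (hg (bot_le' _)).trans (hs_le_l 0 x)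
  set B : ℝ := g (fun _ => 1) - g (fun _ => 0) with hB
  have hgap_nonneg : ∀ x, 0 ≤ u x - l x := fun x => sub_nonneg.2 ((hl_le x).trans (hle_u x))
  have hgap_le : ∀ m x, u x - l x ≤ t m x - s m x := fun m x => sub_le_sub (hu_le_t m x) (hs_le_l m x)
  have hts_le : ∀ m x, t m x - s m x ≤ B := fun m x => sub_le_sub (hg (le_top' _)) (hg (bot_le' _))
  have hgap_int : Integrable (fun x => u x - l x) volume := by
    refine Integrable.mono' (integrable_const B) (hu_meas.sub hl_meas).aestronglyMeasurable
      (Eventually.of_forall fun x => ?_)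
    rw [Real.norm_eq_abs, abs_of_nonneg (hgap_nonneg x)]
    exact (hgap_le 0 x).trans (hts_le 0 x)
  have hint_le : ∀ m : ℕ, ∫ x, (u x - l x) ∂volume ≤ (d : ℝ) * B / ((m : ℝ) + 1) := by
    intro m
    have i1 : Integrable (fun x => t m x) volume := integrable_comp_cubeCell (g ∘ hiCube m)
    have i2 : Integrable (fun x => s m x) volume := integrable_comp_cubeCell (g ∘ loCube m)
    have e1 : ∫ x, t m x ∂volume = upperSum m g := integral_comp_cubeCell (g ∘ hiCube m)
    have e2 : ∫ x, s m x ∂volume = lowerSum m g := integral_comp_cubeCell (g ∘ loCube m)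
    have e : ∫ x, (t m x - s m x) ∂volume = (∫ x, t m x ∂volume) - ∫ x, s m x ∂volume := integral_sub i1 i2
    calc ∫ x, (u x - l x) ∂volume ≤ ∫ x, (t m x - s m x) ∂volume :=
          integral_mono hgap_int (i1.sub i2) fun x => hgap_le m x
      _ = upperSum m g - lowerSum m g := by rw [e, e1, e2]
      _ ≤ (d : ℝ) * B / ((m : ℝ) + 1) := upperSum_sub_lowerSum_le hg m
  have hint_zero : ∫ x, (u x - l x) ∂volume = 0 := by
    refine le_antisymm ?_ (integral_nonneg fun x => hgap_nonneg x)
    have hlim : Tendsto (fun m : ℕ => (d : ℝ) * B / ((m : ℝ) + 1)) atTop (𝓝 0) := by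
      have h := (tendsto_const_div_atTop_nhds_zero_nat ((d : ℝ) * B)).comp (tendsto_add_atTop_nat 1)
      refine h.congr fun m => ?_
      simp only [Function.comp_apply, Nat.cast_add, Nat.cast_one]
    exact ge_of_tendsto' hlim hint_le
  have hae : (fun x => u x - l x) =ᵐ[volume] 0 :=
    (integral_eq_zero_iff_of_nonneg (fun x => hgap_nonneg x) hgap_int).1 hint_zero
  have hgl : g =ᵐ[volume] l := by
    filter_upwards [hae] with x hx
    have hx' : u x = l x := by
      have := hx; simp only [Pi.zero_apply] at this; linarith
    exact le_antisymm ((hle_u x).trans hx'.le) (hl_le x)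
  exact ⟨l, hl_meas, hl_mono, hl_le, hl_low, hgl⟩

variable {n : ℕ}

/-- **Joint moments of a monotone family are those of its Borel regularisation**: the products over `S` agree
a.e., so the integrals agree. [cite: LiebSahi2021, Lemma 2.3 (proof)] -/
theorem integral_prod_congr_ae {f l : Fin n → (Fin d → I) → ℝ} (h : ∀ i, f i =ᵐ[volume] l i)
    (S : Finset (Fin n)) : ∫ x, (∏ i ∈ S, f i) x ∂volume = ∫ x, (∏ i ∈ S, l i) x ∂volume := by
  refine integral_congr_ae ?_
  have hall : ∀ᵐ x ∂(volume : Measure (Fin d → I)), ∀ i, f i x = l i x := ae_all_iff.2 h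
  filter_upwards [hall] with x hx
  simp only [Finset.prod_apply]
  exact Finset.prod_congr rfl fun i _ => hx i

/-- **`E_n` for Lebesgue measure on `Q_d` only needs Borel families**: if `E_n ≥ 0` for all nonnegative monotone
MEASURABLE families then it holds for all nonnegative monotone families (replace each `f_i` by its monotone Borel
regularisation, a.e. equal to it, with the same joint moments). [cite: LiebSahi2021, Lemma 2.3 (proof)] -/
theorem mSahiPositive_volume_of_measurable (h : ∀ f : Fin n → (Fin d → I) → ℝ, (∀ i, Measurable (f i)) →
      (∀ i x, 0 ≤ f i x) → (∀ i, Monotone (f i)) → 0 ≤ msahiE (volume : Measure (Fin d → I)) n f) :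
    MSahiPositive (volume : Measure (Fin d → I)) n := by
  intro f hf0 hmono
  choose l hlm hlmono hlle hllow hfl using fun i => (hmono i).exists_measurable_monotone_ae_eq_unitCube
  have hE : msahiE (volume : Measure (Fin d → I)) n f = msahiE (volume : Measure (Fin d → I)) n l :=
    msahiE_congr_of_moments _ _ f l fun S => integral_prod_congr_ae hfl S
  rw [hE]
  exact h l hlm (fun i x => (hf0 i _).trans (hllow i x)) hlmono

end LebesgueCube

end Literature.Combinatorics.Sahi2008
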